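import Summits.BirchSwinnertonDyer.BirchSwinnertonDyer.Theses.PrintCf2
import Summits.BirchSwinnertonDyer.Rank1Residual.P2.KrizLiTwoFortyThreeSlices
import HarnessLib

/-!
# Route PrintCf2 — aside item `SmallConductorOfFacts` CLOSED (the finite printed sub-slice of the leaf)

Cell `bsd-print-cf2` (D-0131 (2) PRINT TIER, leaf CornerF @ `p = 2`), prover p3. Granted Creutz–Miller 2012
Thm 1.1 / Miller 2011 / Miller–Stoll 2013 BY NAME (`bsdTriple_of_analyticRank_le_one_of_conductor_lt`:
full BSD for every `E/ℚ` with `r_an ≤ 1` and `N < 5000`), every globally minimal CM curve of analytic rank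
one and conductor `< 5000` satisfies `BSD(E,2)` — 140 curves / 56 isogeny classes of the leaf (lit census
§14.2), among them every base curve of the print routes (`27a`, `36a`, `243a`, `121b`, …). Proof:
`P2.cornerFTwo_of_conductor_lt_5000` (p545619). beyond-print: NO. [cite: CreutzMiller2012, Thm. 1.1]
[cite: MillerStoll2012, Thm. 9.1] [cite: Miller2011LMS, Thm. 1.2 and Def. 1.1]
-/

-- single-conjunct summit: `Summit.BirchSwinnertonDyer.BirchSwinnertonDyer.…` repeats the name by design
set_option linter.dupNamespace false

namespace Summit.BirchSwinnertonDyer.BirchSwinnertonDyer.Theorems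

/-- **Item `SmallConductorOfFacts` holds**: Creutz–Miller ⟹ `BSD(W,2)` for every globally minimal CM
curve of analytic rank one with `N(W) < 5000`. [cite: CreutzMiller2012, Thm. 1.1] [cite: Miller2011LMS, Def. 1.1] -/
theorem smallConductorOfFacts_proof :
    Summit.BirchSwinnertonDyer.BirchSwinnertonDyer.Theses.PrintCf2.SmallConductorOfFacts := by
  unfold Summit.BirchSwinnertonDyer.BirchSwinnertonDyer.Theses.PrintCf2.SmallConductorOfFacts
  intro hS31 W _ _ hcm hr hN
  exact Summit.BirchSwinnertonDyer.Rank1Residual.P2.cornerFTwo_of_conductor_lt_5000 hS31 W hcm hr hN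

end Summit.BirchSwinnertonDyer.BirchSwinnertonDyer.Theorems
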